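import Summits.CriticalPhenomena.PercolationContinuityZ3.Theorems.Transplant.Bcc111HubRoute
import Summits.CriticalPhenomena.PercolationContinuityZ3.Theorems.Transplant.Bcc111HubKit5
import Summits.CriticalPhenomena.PercolationContinuityZ3.Theorems.Transplant.Bcc111HubLegs5
import HarnessLib

/-!
# The bcc (111)-films `F_m(bcc)`, exit-form routing certificate VIII⁵: A SWAP PAIR OF ROUTINGS FROM A CLAW AT THICKNESS `m ≥ 5` (both hub extremes kept)

builds on p205010 (kernel theorem, internal audit signed; external expert review pending) — NOT used in this file.
Lane `prim-bschramm`, seat `prim-bschramm-p2` (gen 48; class C1b, METHOD = input substitution; memo `HOME/bschramm/P2-LATTICES.md` §159); helper file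
(`--supports stmt-CriticalPhenomena-4575 --as helper`).  **`Bcc111.swapPair_of_claw5`** (verbatim «Bcc111HubRoute».`swapPair_of_claw` over «Bcc111HubKit5».`exists_hubFacts5`, `m ≥ 5`, given that both extreme vertices of the hub column are kept): for a claw of the planar model («Bcc111ClawSound».`ClawProps`) whose targets are
the columns of the terminals `Ea, Eb` (rerouting set) and `w'` (cleared set) — with, when `Ea, Eb` share a column, `Ea` below `Eb` and the stacked type of their levels —
the `K_{2,3}` elevator hub («Bcc111HubKit»), the three 3D legs («Bcc111HubLegs»: from the chain ports over the chain-port columns, and from `n` through the first vertex over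
the exit column) and «BccSlabHubRoute».`VRouteData.swapPair_of_hub` give a SWAP PAIR of `VRouteData` for `(E₁, E₂, w')` in either order of `{Ea, Eb}`.
Column-disjointness of the planar legs gives vertex-disjointness; the stacked legs meet the common column only at their own terminals.
[cite: DuminilCopinSidoraviciusTassion2016, §2.3 (proof of Fact 2: the three disjoint paths γ_u, γ_v, γ_w in B̄_R(z))] [cite: ConwaySloane1999, Ch. 4 §7.1]
-/

noncomputable section

namespace Summit.CriticalPhenomena.PercolationContinuityZ3.Theorems.Transplant

namespace Bcc111

open MeasureTheory Literature.Probability.Percolation Literature.Probability.LatticeModels SimpleGraph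
open Slab111 (lev)
open BccClawX (Pt rel)
open Bcc111Claw (tnZ inRB inDB rem0 remM penLo penHi penult LegProps ClawProps uvec others hubCols)
open scoped Classical

variable {m : ℕ}

/-- **A SWAP PAIR OF ROUTINGS FROM A CLAW, `m ≥ 5`**, both extreme vertices of the hub column kept. [cite: DuminilCopinSidoraviciusTassion2016, §2.3 (proof of Fact 2)] -/
theorem swapPair_of_claw5 (hm : 5 ≤ m) (z : Site 2) {tR tD sR sD : ℕ} (htRD : tR ≤ tD) (hsRD : sR ≤ sD)
    {a1 a2 a3 : Pt} {ty : ℕ} {Q : Pt} {i : ℕ} {up : Bool} {bc F0 F1 X0 X1 s1 s2 s3 : Pt} {l1 l2 l3 : List Pt}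
    (hP : ClawProps (min tR 3) (min tD 3) (min sR 3) (min sD 3) a1 a2 a3 ty Q i up bc F0 F1 X0 X1 s1 s2 s3 l1 l2 l3)
    (hQ0 : rem0 (min tR 3) (min sR 3) Q = false) (hQm : remM (min tR 3) (min sR 3) Q = false) {Ea Eb w' : bfilm m} (hEa : rel z (sh Ea) = a1) (hEb : rel z (sh Eb) = a2) (hw : rel z (sh w') = a3) (hne : Ea ≠ Eb)
    (hEaW : Ea ∈ clearedSet m z tR tD sR sD ∩ (hexShadow m).lift (blkR 3 z tR sR))
    (hEbW : Eb ∈ clearedSet m z tR tD sR sD ∩ (hexShadow m).lift (blkR 3 z tR sR)) (hwW : w' ∈ clearedSet m z tR tD sR sD)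
    (hstk : a1 = a2 → lev (pt Ea) < lev (pt Eb) ∧ ((ty / 3 : ℕ) : ℤ) = min (lev (pt Ea)) 2 ∧ ((ty % 3 : ℕ) : ℤ) = min ((m : ℤ) - lev (pt Eb)) 2)
    {E₁ E₂ : bfilm m} (hE : (E₁ = Ea ∧ E₂ = Eb) ∨ (E₁ = Eb ∧ E₂ = Ea)) :
    ∃ r₁ r₂ : VRouteData (film m) (clearedSet m z tR tD sR sD ∩ (hexShadow m).lift (blkR 3 z tR sR)) (clearedSet m z tR tD sR sD) E₁ E₂ w',
      r₁.y = r₂.b ∧ r₁.b = r₂.y := by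
  set WR := clearedSet m z tR tD sR sD ∩ (hexShadow m).lift (blkR 3 z tR sR) with hWRdef
  set W := clearedSet m z tR tD sR sD with hWdef
  have hWRW : WR ⊆ W := fun x hx => hx.1
  have hm5 : 5 ≤ m := hm
  obtain ⟨y, b, n, p0, p1, x0, x1, H⟩ := exists_hubFacts5 hm z htRD hsRD hP.hh hP.hi hP.hQ hQ0 hQm hP.hbc
  obtain ⟨hF0X0, hF0X1, hF1X0, hF1X1⟩ := F_ne_X z hP.hh hP.hi
  obtain ⟨A, B, X, hAB, hX, harr⟩ := hP.hst
  -- flags: which start columns are exit columns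
  have hnotX : ∀ {s : Pt}, s = A ∨ s = B → ¬ (s = X0 ∨ s = X1) := by
    rintro s hs (rfl | rfl) <;> rcases hAB with ⟨rfl, rfl⟩ | ⟨rfl, rfl⟩ <;> rcases hs with h | h <;>
      first | exact hF0X0 h.symm | exact hF0X1 h.symm | exact hF1X0 h.symm | exact hF1X1 h.symm
  have hall : ∀ {s : Pt}, s = A ∨ s = B ∨ s = X → s = F0 ∨ s = F1 ∨ s = X0 ∨ s = X1 := by
    rintro s (rfl | rfl | rfl)
    · rcases hAB with ⟨rfl, -⟩ | ⟨rfl, -⟩ <;> simp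
    · rcases hAB with ⟨-, rfl⟩ | ⟨-, rfl⟩ <;> simp
    · rcases hX with rfl | rfl <;> simp
  have hs123 : (s1 = F0 ∨ s1 = F1 ∨ s1 = X0 ∨ s1 = X1) ∧ (s2 = F0 ∨ s2 = F1 ∨ s2 = X0 ∨ s2 = X1) ∧ (s3 = F0 ∨ s3 = F1 ∨ s3 = X0 ∨ s3 = X1) ∧
      ¬ ((s1 = X0 ∨ s1 = X1) ∧ (s2 = X0 ∨ s2 = X1)) ∧ ¬ ((s1 = X0 ∨ s1 = X1) ∧ (s3 = X0 ∨ s3 = X1)) ∧ ¬ ((s2 = X0 ∨ s2 = X1) ∧ (s3 = X0 ∨ s3 = X1)) := by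
    rcases harr with h | h | h <;> simp only [Prod.mk.injEq] at h <;> obtain ⟨rfl, rfl, rfl⟩ := h
    · exact ⟨hall (Or.inr (Or.inr rfl)), hall (Or.inl rfl), hall (Or.inr (Or.inl rfl)), fun h => hnotX (Or.inl rfl) h.2, fun h => hnotX (Or.inr rfl) h.2,
        fun h => hnotX (Or.inl rfl) h.1⟩
    · exact ⟨hall (Or.inl rfl), hall (Or.inr (Or.inr rfl)), hall (Or.inr (Or.inl rfl)), fun h => hnotX (Or.inl rfl) h.1, fun h => hnotX (Or.inl rfl) h.1,
        fun h => hnotX (Or.inr rfl) h.2⟩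
    · exact ⟨hall (Or.inl rfl), hall (Or.inr (Or.inl rfl)), hall (Or.inr (Or.inr rfl)), fun h => hnotX (Or.inl rfl) h.1, fun h => hnotX (Or.inl rfl) h.1,
        fun h => hnotX (Or.inr rfl) h.1⟩
  obtain ⟨hs1, hs2, hs3, hx12, hx13, hx23⟩ := hs123
  -- start kits: port `c`, first lifted vertex `v`, and the prefix `pre` from `c` to `v`
  have kit : ∀ s : Pt, (s = F0 ∨ s = F1 ∨ s = X0 ∨ s = X1) →
      ∃ (c v : bfilm m) (pre : List (bfilm m)), GPath (film m) pre c v ∧ (film m).Adj y c ∧ (film m).Adj b c ∧ rel z (sh v) = s ∧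
        1 ≤ lev (pt v) ∧ lev (pt v) ≤ (m : ℤ) - 1 ∧ (∀ x ∈ pre, x = v ∨ ((s = X0 ∨ s = X1) ∧ x = n)) ∧ (∀ x ∈ pre, x ∈ WR ∨ x = v) := by
    rintro s (rfl | rfl | rfl | rfl)
    · exact ⟨p0, p0, [p0], GPath.single _ _, H.yp0, H.bp0, H.shp0, H.levp0.1, H.levp0.2, by simp, by simp⟩
    · exact ⟨p1, p1, [p1], GPath.single _ _, H.yp1, H.bp1, H.shp1, H.levp1.1, H.levp1.2, by simp, by simp⟩
    · exact ⟨n, x0, [n, x0], GPath.pair H.nx0, H.yn, H.bn, H.shx0, H.levx0.1, H.levx0.2,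
        fun x hx => by simp only [List.mem_cons, List.not_mem_nil, or_false] at hx; rcases hx with rfl | rfl <;> simp,
        fun x hx => by simp only [List.mem_cons, List.not_mem_nil, or_false] at hx; rcases hx with rfl | rfl; exacts [Or.inl H.nWR, Or.inr rfl]⟩
    · exact ⟨n, x1, [n, x1], GPath.pair H.nx1, H.yn, H.bn, H.shx1, H.levx1.1, H.levx1.2,
        fun x hx => by simp only [List.mem_cons, List.not_mem_nil, or_false] at hx; rcases hx with rfl | rfl <;> simp,
        fun x hx => by simp only [List.mem_cons, List.not_mem_nil, or_false] at hx; rcases hx with rfl | rfl; exacts [Or.inl H.nWR, Or.inr rfl]⟩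
  -- avoid lists
  have hav1 : Q ∉ l1 ∧ bc ∉ l1 ∧ a3 ∉ l1 := by
    refine ⟨fun h => ?_, fun h => ?_, fun h => ?_⟩ <;> have := hP.leg1.not_avoid _ h <;> split_ifs at this <;> simp at this
  have hav2 : Q ∉ l2 ∧ bc ∉ l2 ∧ a3 ∉ l2 := by
    refine ⟨fun h => ?_, fun h => ?_, fun h => ?_⟩ <;> have := hP.leg2.not_avoid _ h <;> split_ifs at this <;> simp at this
  have hav3 : Q ∉ l3 ∧ bc ∉ l3 ∧ a1 ∉ l3 ∧ a2 ∉ l3 := by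
    refine ⟨fun h => ?_, fun h => ?_, fun h => ?_, fun h => ?_⟩ <;> have := hP.leg3.not_avoid _ h <;> simp at this
  -- region facts
  have hS12 : ∀ {l : List Pt}, (∀ w ∈ l, inRB (min tR 3) (min sR 3) w = true) →
      ∀ x : bfilm m, rel z (sh x) ∈ l → 1 ≤ lev (pt x) → lev (pt x) ≤ (m : ℤ) - 1 → x ∈ WR :=
    fun hR x hx h1 h2 => mem_WR_of_lev htRD hsRD (hR _ hx) h1 h2
  have hS3 : ∀ x : bfilm m, rel z (sh x) ∈ l3 → 1 ≤ lev (pt x) → lev (pt x) ≤ (m : ℤ) - 1 → x ∈ W :=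
    fun x hx h1 h2 => mem_W_of_lev (hP.leg3.mem_R _ hx) h1 h2
  -- the three 3D legs, each: full list `F`, port `c`, flag `s ∈ {X0, X1}`
  have legE : ∀ (lower : Bool) (E E' : bfilm m) (s a : Pt) (l : List Pt) (avoid : List Pt), (s = F0 ∨ s = F1 ∨ s = X0 ∨ s = X1) →
      LegProps (inRB (min tR 3) (min sR 3)) avoid s a l → rel z (sh E) = a → E ∈ WR → Q ∉ l →
      (a1 = a2 → sh E = sh E' ∧ (lower = true → lev (pt E) < lev (pt E') ∧ penLo (min tR 3) (min sR 3) a (ty / 3) (penult l) = true ∧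
          ((ty / 3 : ℕ) : ℤ) = min (lev (pt E)) 2) ∧
        (lower = false → lev (pt E') < lev (pt E) ∧ penHi (min tR 3) (min sR 3) a (ty % 3) (penult l) = true ∧
          ((ty % 3 : ℕ) : ℤ) = min ((m : ℤ) - lev (pt E)) 2)) →
      ∃ (c : bfilm m) (Fl : List (bfilm m)), GPath (film m) Fl c E ∧ (film m).Adj y c ∧ (film m).Adj b c ∧ (∀ x ∈ Fl, x ∈ WR) ∧
        (∀ x ∈ Fl, ((s = X0 ∨ s = X1) ∧ x = n) ∨ (rel z (sh x) ∈ l ∧ (a1 = a2 → rel z (sh x) ∈ l.dropLast ∨ x = E))) := by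
    intro lower E E' s a l avoid hs hl hE hEW hQl hst
    obtain ⟨c, v, pre, hpre, hyc, hbc', hv, hv1, hvm, hpre1, hpre2⟩ := kit s hs
    -- the lifted part
    obtain ⟨L, hL, hLW, hLcol⟩ : ∃ L : List (bfilm m), GPath (film m) L v E ∧ (∀ x ∈ L, x ∈ WR) ∧
        (∀ x ∈ L, rel z (sh x) ∈ l ∧ (a1 = a2 → rel z (sh x) ∈ l.dropLast ∨ x = E)) := by
      by_cases heq : a1 = a2
      · obtain ⟨hsh, hlo, hhi⟩ := hst heq
        cases lower with
        | true =>
          obtain ⟨hlt, hpen, hτ⟩ := hlo rfl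
          obtain ⟨L, hL, hLW, hLc⟩ := leg_exact_lo5 hm z htRD hsRD hl hpen v E E' hv hv1 hvm hE hsh hlt hτ hEW
          refine ⟨L, hL, hLW, fun x hx => ⟨?_, fun _ => hLc x hx⟩⟩
          rcases hLc x hx with h | rfl
          · exact List.dropLast_subset l h
          · rw [hE, ← hl.last]; exact List.getLast_mem _
        | false =>
          obtain ⟨hlt, hpen, hτ⟩ := hhi rfl
          obtain ⟨L, hL, hLW, hLc⟩ := leg_exact_hi5 hm z htRD hsRD hl hpen v E' E hv hv1 hvm hE hsh.symm hlt hτ hEW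
          refine ⟨L, hL, hLW, fun x hx => ⟨?_, fun _ => hLc x hx⟩⟩
          rcases hLc x hx with h | rfl
          · exact List.dropLast_subset l h
          · rw [hE, ← hl.last]; exact List.getLast_mem _
      · obtain ⟨L, hL, hLW, hLc⟩ := leg_plain hm5 z hl (hS12 hl.mem_R) v E hv hv1 hvm hE hEW
        exact ⟨L, hL, hLW, fun x hx => ⟨hLc x hx, fun h => absurd h heq⟩⟩
    have hnL : n ∉ L := fun h => hQl (by have := (hLcol n h).1; rwa [H.shn] at this)
    refine ⟨c, pre ++ L.tail, hpre.trans hL (fun x hx hxp => ?_), hyc, hbc', fun x hx => ?_, fun x hx => ?_⟩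
    · rcases hpre1 x hxp with h | ⟨-, h⟩
      · exact h
      · exact absurd hx (h ▸ hnL)
    · rcases List.mem_append.1 hx with hx | hx
      · rcases hpre2 x hx with h | rfl
        · exact h
        · exact hLW _ hL.head_mem
      · exact hLW _ (List.mem_of_mem_tail hx)
    · rcases List.mem_append.1 hx with hx | hx
      · rcases hpre1 x hx with rfl | h
        · exact Or.inr (hLcol _ hL.head_mem)
        · exact Or.inl h
      · exact Or.inr (hLcol _ (List.mem_of_mem_tail hx))
  -- the terminal legs
  have hshab : a1 = a2 → sh Ea = sh Eb := fun h => rel_injective z (by rw [hEa, hEb, h])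
  obtain ⟨cA, FA, hFA, hycA, hbcA, hFAW, hFAc⟩ := legE true Ea Eb s1 a1 l1 _ hs1 hP.leg1 hEa hEaW hav1.1
    (fun h => ⟨hshab h, fun _ => ⟨(hstk h).1, hP.pen1 h, (hstk h).2.1⟩, fun hf => absurd hf (by simp)⟩)
  obtain ⟨cB, FB, hFB, hycB, hbcB, hFBW, hFBc⟩ := legE false Eb Ea s2 a2 l2 _ hs2 hP.leg2 hEb hEbW hav2.1
    (fun h => ⟨(hshab h).symm, fun hf => absurd hf (by simp), fun _ => ⟨(hstk h).1, by rw [← h]; exact hP.pen2 h, (hstk h).2.2⟩⟩)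
  -- the leg to `w'`
  obtain ⟨cC, FC, hFC, hycC, hbcC, hFCW, hFCc⟩ : ∃ (c : bfilm m) (Fl : List (bfilm m)), GPath (film m) Fl c w' ∧ (film m).Adj y c ∧ (film m).Adj b c ∧
      (∀ x ∈ Fl, x ∈ W) ∧ (∀ x ∈ Fl, ((s3 = X0 ∨ s3 = X1) ∧ x = n) ∨ rel z (sh x) ∈ l3) := by
    obtain ⟨c, v, pre, hpre, hyc, hbc', hv, hv1, hvm, hpre1, hpre2⟩ := kit s3 hs3
    obtain ⟨L, hL, hLW, hLcol⟩ := leg_plain hm5 z hP.leg3 hS3 v w' hv hv1 hvm hw hwW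
    have hnL : n ∉ L := fun h => hav3.1 (by have := hLcol n h; rwa [H.shn] at this)
    refine ⟨c, pre ++ L.tail, hpre.trans hL (fun x hx hxp => ?_), hyc, hbc', fun x hx => ?_, fun x hx => ?_⟩
    · rcases hpre1 x hxp with h | ⟨-, h⟩
      · exact h
      · exact absurd hx (h ▸ hnL)
    · rcases List.mem_append.1 hx with hx | hx
      · rcases hpre2 x hx with h | rfl
        · exact hWRW h
        · exact hLW _ hL.head_mem
      · exact hLW _ (List.mem_of_mem_tail hx)
    · rcases List.mem_append.1 hx with hx | hx
      · rcases hpre1 x hx with rfl | h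
        · exact Or.inr (hLcol _ hL.head_mem)
        · exact Or.inl h
      · exact Or.inr (hLcol _ (List.mem_of_mem_tail hx))
  -- disjointness
  have ha1l1 : a1 = a2 → a1 ∉ l1.dropLast := fun _ => (hP.leg1.split).2.2.1
  have ha2l2 : a1 = a2 → a2 ∉ l2.dropLast := fun _ => (hP.leg2.split).2.2.1
  have hAB : ∀ x ∈ FA, x ∉ FB := by
    intro x hxA hxB
    rcases hFAc x hxA with ⟨f1, rfl⟩ | ⟨c1, f1⟩ <;> rcases hFBc x hxB with ⟨f2, e2⟩ | ⟨c2, f2⟩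
    · exact hx12 ⟨f1, f2⟩
    · rw [H.shn] at c2; exact hav2.1 c2
    · rw [e2, H.shn] at c1; exact hav1.1 c1
    · by_cases heq : a1 = a2
      · rcases f1 heq with d1 | rfl <;> rcases f2 heq with d2 | e
        · obtain ⟨-, hw⟩ := hP.d12 _ (List.dropLast_subset _ d1) (List.dropLast_subset _ d2)
          exact ha1l1 heq (hw ▸ d1)
        · rw [e, hEb] at d1; exact ha1l1 heq (heq ▸ d1)
        · rw [hEa] at d2; exact ha2l2 heq (heq ▸ d2)
        · exact hne e
      · exact heq (hP.d12 _ c1 c2).1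
  have hAC : ∀ x ∈ FA, x ∉ FC := by
    intro x hxA hxC
    rcases hFAc x hxA with ⟨f1, rfl⟩ | ⟨c1, -⟩ <;> rcases hFCc x hxC with ⟨f3, e3⟩ | c3
    · exact hx13 ⟨f1, f3⟩
    · rw [H.shn] at c3; exact hav3.1 c3
    · rw [e3, H.shn] at c1; exact hav1.1 c1
    · exact hP.d31 _ c3 c1
  have hBC : ∀ x ∈ FB, x ∉ FC := by
    intro x hxB hxC
    rcases hFBc x hxB with ⟨f2, rfl⟩ | ⟨c2, -⟩ <;> rcases hFCc x hxC with ⟨f3, e3⟩ | c3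
    · exact hx23 ⟨f2, f3⟩
    · rw [H.shn] at c3; exact hav3.1 c3
    · rw [e3, H.shn] at c2; exact hav2.1 c2
    · exact hP.d32 _ c3 c2
  have hyA : y ∉ FA := fun h => by
    rcases hFAc y h with ⟨-, e⟩ | ⟨c1, -⟩
    · exact H.y_ne_n e
    · rw [H.shy] at c1; exact hav1.1 c1
  have hyB : y ∉ FB := fun h => by
    rcases hFBc y h with ⟨-, e⟩ | ⟨c2, -⟩
    · exact H.y_ne_n e
    · rw [H.shy] at c2; exact hav2.1 c2
  have hyC : y ∉ FC := fun h => by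
    rcases hFCc y h with ⟨-, e⟩ | c3
    · exact H.y_ne_n e
    · rw [H.shy] at c3; exact hav3.1 c3
  have hbA : b ∉ FA := fun h => by
    rcases hFAc b h with ⟨-, e⟩ | ⟨c1, -⟩
    · exact H.b_ne_n e
    · rw [H.shb] at c1; exact hav1.2.1 c1
  have hbB : b ∉ FB := fun h => by
    rcases hFBc b h with ⟨-, e⟩ | ⟨c2, -⟩
    · exact H.b_ne_n e
    · rw [H.shb] at c2; exact hav2.2.1 c2
  have hbC : b ∉ FC := fun h => by
    rcases hFCc b h with ⟨-, e⟩ | c3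
    · exact H.b_ne_n e
    · rw [H.shb] at c3; exact hav3.2.1 c3
  rcases hE with ⟨rfl, rfl⟩ | ⟨rfl, rfl⟩
  · exact VRouteData.swapPair_of_hub hFA hFB hFC hne hFAW hFBW hFCW H.yWR H.bWR hWRW hycA.symm hbcA.symm hycB hbcB hycC hbcC H.y_ne_b
      hAB hAC hBC hyA hyB hyC hbA hbB hbC
  · exact VRouteData.swapPair_of_hub hFB hFA hFC hne.symm hFBW hFAW hFCW H.yWR H.bWR hWRW hycB.symm hbcB.symm hycA hbcA hycC hbcC H.y_ne_b
      (fun x hx hx' => hAB x hx' hx) hBC hAC hyB hyA hyC hbB hbA hbC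

end Bcc111

end Summit.CriticalPhenomena.PercolationContinuityZ3.Theorems.Transplant

end
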